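import Summits.ResolutionOfSingularities.ResolutionOfSingularities.Theorems.MarkedTransferCampaignW46OurProcedure
import HarnessLib

/-!
# [OURS · L1 W4.6 rung (i-h)] WHEN PHASE 0 ENDS: a surface state admits no good procrastination iff every singular curve is
# regular (cell res-hironaka, LADDER-RESOLUTION rung L, D-0089; campaign s46, prover res-L1-s46-pv-1; host route
# MarkedTransfer, `--supports stmt-ResolutionOfSingularities-16155`)

HONEST FRAMING. Nothing here is a statement of H. Hironaka's manuscript (2017-03-23, [Hironaka2017]) and nothing here
asserts that any statement of it holds. OURS bookkeeping over `…OurProcedure` (p540391) and `…GoodProcrastination`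
(p539260). AI-written; weaker than expert review. No `sorry`; axioms standard.

## What

`singCurvesRegular_iff_forall_not_centreGoodProcrastination` — for a standard ideal exponent `E` on an ambient datum of
dimension `≤ 2` (any field): `Regime.singCurvesRegular A E` (the class in which the honest procedure of rung (i-g) runs)
holds IFF no closed subset is a good procrastination for `E`. So PHASE 0 of OUR procedure (good procrastinations while
they exist) ends EXACTLY when the class of rung (i-g) is reached, and OUR centre rule (`OurCentre`) licenses, at every
unresolved surface state, either only good procrastinations or only honest centres (`ourCentre_iff`).

## References

* companions `…OurProcedure` (p540391), `…GoodProcrastination` (p539260), `…HonestPersistence` (p535455).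
* H. Hironaka, ms. 2017-03-23, Th. 16.6 p.84 l.4–9 — scope only, under adjudication, not cited as fact. [Hironaka2017]
-/

noncomputable section

set_option linter.dupNamespace false -- mandated namespace of this single-conjunct summit

open CategoryTheory AlgebraicGeometry TopologicalSpace

namespace Summit.ResolutionOfSingularities.ResolutionOfSingularities.Theorems

namespace CampaignW46

open Literature.AlgebraicGeometry.Resolution
open Literature.AlgebraicGeometry.Hironaka2017.S02Preliminaries
open Literature.AlgebraicGeometry.Hironaka2017.Datum
open Scheme.IdealSheafData

universe u

variable {p : ℕ} [Fact p.Prime] {K : Type u} [Field K] [CharP K p]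

/-- **A singular curve of `E` which is singular somewhere yields a good procrastination** (at a closed point: the
singular point read on a member of a curve family, whose points outside the regular locus are closed). [folklore] -/
theorem exists_centreGoodProcrastination_of_not_isRegular (A : AmbientDatum p K) {E : IdealExponent A.Z}
    (hE : E.IsStandard) (hdimZ : topologicalKrullDim A.Z ≤ 2) {η : A.Z} (hηS : η ∈ E.sing)
    (hncl : ¬ IsClosed ({η} : Set A.Z)) (hnreg : ¬ Scheme.IsRegular (primeDivisorIdeal η).subscheme) :
    ∃ ξ : A.Z, ∃ hξ : IsClosed ({ξ} : Set A.Z), ξ ∈ E.sing ∧ CentreGoodProcrastination E ⟨{ξ}, hξ⟩ := by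
  classical
  haveI : IsLocallyNoetherian A.Z := ambient_isLocallyNoetherian A
  haveI hint : IsIntegral (primeDivisorIdeal η).subscheme :=
    isIntegral_subscheme_vanishingIdeal _ isIrreducible_singleton.closure
  obtain ⟨c, hc⟩ : ∃ c : (primeDivisorIdeal η).subscheme, c ∉ Scheme.regularLocus _ := not_forall.mp hnreg
  obtain ⟨n, ι, hι, ζ, C, i, hfam, -, hrange, -⟩ := exists_hasCurveFamily A hE hdimZ
  have hηdiv : η ∈ divisorialPoints E.J := mem_divisorialPoints_of_mem_sing A hE hdimZ hηS hncl
  rw [← hrange] at hηdiv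
  obtain ⟨k₀, hk₀⟩ := hηdiv
  haveI := (hfam k₀).1
  haveI := (hfam k₀).2.1
  haveI := (hfam k₀).2.2.1
  have hgen : (primeDivisorIdeal η).subschemeι (genericPoint _) = i k₀ (genericPoint (C k₀)) := by
    rw [subschemeι_genericPoint_primeDivisorIdeal, (hfam k₀).2.2.2.2.2, hk₀]
  obtain ⟨c₀, hc₀ξ, hc₀reg⟩ := exists_point_of_same_image _ (i k₀) hgen c
  have hc₀ : c₀ ∉ Scheme.regularLocus (C k₀) := fun h => hc (hc₀reg.mp h)
  have hc₀cl : IsClosed ({c₀} : Set (C k₀)) :=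
    isClosed_singleton_of_not_mem_regularLocus_of_dim_le_one (hfam k₀).2.2.2.1 (hfam k₀).2.2.2.2.1 hc₀
  have hξcl : IsClosed ({i k₀ c₀} : Set A.Z) := by
    rw [← Set.image_singleton]
    exact (i k₀).isClosedEmbedding.isClosedMap _ hc₀cl
  have hξmem : i k₀ c₀ ∈ closure ({η} : Set A.Z) := by
    rw [hc₀ξ, ← coe_support_primeDivisorIdeal, ← Scheme.IdealSheafData.range_subschemeι]
    exact ⟨c, rfl⟩
  have hξS : i k₀ c₀ ∈ E.sing :=
    (A.isClosed_sing E).closure_subset_iff.mpr (Set.singleton_subset_iff.mpr hηS) hξmem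
  exact ⟨i k₀ c₀, hξcl, hξS, i k₀ c₀, η, rfl, hηS, hncl, c, hc₀ξ.symm, hc⟩

/-- [OURS · L1 W4.6 rung (i-h)] NOT a statement of the manuscript. **PHASE 0 ENDS EXACTLY AT THE CLASS OF RUNG (i-g).**
For a standard ideal exponent on an ambient datum of dimension `≤ 2`: every singular curve is regular
(`Regime.singCurvesRegular`) iff no closed subset is a good procrastination. [folklore] -/
theorem singCurvesRegular_iff_forall_not_centreGoodProcrastination (A : AmbientDatum p K) {E : IdealExponent A.Z}
    (hE : E.IsStandard) (hdimZ : topologicalKrullDim A.Z ≤ 2) :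
    Regime.singCurvesRegular A E ↔ ∀ D : Closeds A.Z, ¬ CentreGoodProcrastination E D := by
  constructor
  · exact fun hP D => not_centreGoodProcrastination_of_singCurvesRegular A hP D
  · intro h η hηS hncl
    by_contra hnreg
    obtain ⟨ξ, hξ, -, hgood⟩ := exists_centreGoodProcrastination_of_not_isRegular A hE hdimZ hηS hncl hnreg
    exact h _ hgood

/-- [OURS · L1 W4.6 rung (i-h)] NOT a statement of the manuscript. **OUR centre rule, read per state**: a centre obeys
OUR rule iff EITHER some singular curve is singular somewhere and the centre is a good
procrastination, OR every singular curve is regular and the centre does not procrastinate. [folklore] -/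
theorem ourCentre_iff (A : AmbientDatum p K) {E : IdealExponent A.Z} (D : Closeds A.Z) :
    OurCentre A E D ↔
      (¬ Regime.singCurvesRegular A E ∧ CentreGoodProcrastination E D) ∨
        (Regime.singCurvesRegular A E ∧ ¬ CentreProcrastinates E D) := by
  constructor
  · rintro (hg | hh)
    · exact Or.inl ⟨fun hP => not_centreGoodProcrastination_of_singCurvesRegular A hP D hg, hg⟩
    · exact Or.inr hh
  · rintro (⟨-, hg⟩ | hh)
    · exact Or.inl hg
    · exact Or.inr hh

end CampaignW46

end Summit.ResolutionOfSingularities.ResolutionOfSingularities.Theorems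

end
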